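import Summits.AtomisticToContinuum.Crystallization.Theorems.FluxTubeKeplerFloorGivesLayered
import Summits.AtomisticToContinuum.Crystallization.Theorems.FluxTubeKeplerFluxCellKeplerSingleScale
import Summits.AtomisticToContinuum.Crystallization.Theorems.ChessboardParticlePlanesPeriodicWindowsIffCrystallization
import Summits.AtomisticToContinuum.Crystallization.Theorems.FluxTubeKeplerKeplerEnergyFloor
import Summits.AtomisticToContinuum.Crystallization.Theorems.FluxTubeKeplerFluxCellKeplerGoodSitesWindows

/-!
# Forward rung `EnergyBlindRung` — the ENERGY-FILTER ladder over `FluxTubeKepler.FloorGivesLayered`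

Crux `FluxTubeKepler.FluxCellKepler` (stmt-AtomisticToContinuum-15221), line `EnergyBlindRung`
(forward generator G1, gen 7; floor = the PROVED `FloorGivesLayered` (stmt-15223,
`FluxTubeKeplerFloorGivesLayered.FloorGivesLayered_proof`).

THE DIAL.  The floor says: FLOOR(P₀) (`N·e(P₀) ≤ E(x)` on ground states) + BUDGET(P₀) (at every scale
`(R, η)` a constant `c > 0` with `c · #{(R,η)-bad sites} ≤ E(x) − N·e(P₀)` on ground states) ⇒ layered
(hence periodic) windows along every ground-state sequence.  Here the budget is FILTERED BY ENERGY: at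
scale `(R, η)` only the `(R, η)`-bad sites whose Lennard-Jones SITE-ENERGY SURPLUS
`𝓔ⁱ(x) − 2·e(P₀)` is at least a threshold `θ R η : WithBot ℝ` are priced.  `θ ≡ ⊥` prices every bad
site — `ERung ⊥` IS the floor (`eRung_bot`, F3) — and the family is monotone in `θ` (`eRung_anti`:
raising the threshold un-prices more sites, so the rung gets stronger).  The deciding rung
`EnergyBlindRung := ∃ θ : ℝ → ℝ → ℝ, θ > 0 pointwise ∧ ERung ↑θ` un-prices, at every scale, the bad
sites that are energetically (almost) as well bound as a bulk site of the optimal crystal — in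
particular EVERY over-bound frustrated site (icosahedral centres, surplus < 0), the witness class of
the barrier `TetrahedralFrustration` — and asks that ground states still have periodic windows.

ON PATH (F4): `Crystallization → ERung θ` for every `θ` (`eRung_of_crystallization`, through the landed
`periodicWindows_of_crystallization`), in particular `EnergyBlindRung_of_Crystallization`.
RELIEF for the parent crux: `windows_of_energyBlindRung` — with the rung, the Kepler-type budget of
route `FluxTubeKepler` is needed only for ENERGY-ANOMALOUS bad sites (`EKeplerFloor ↑θ` for positive
`θ`; the parent crux supplies it a fortiori, `eKeplerFloor_of_fluxCellKepler`) to give periodic windows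
along ground states, i.e. `Crystallization` by the landed `crystallization_of_periodicWindows`.

THE LINE (2 registered stubs + sorry-free composition `EnergyBlindRung_of`):
* `stub_localEnergyRigidity` (XL, the bet — LOCAL ENERGY RIGIDITY): there is a pointwise-positive
  threshold `θ(R, η)` such that, for `δ`-separated finite configurations, a ball of radius
  `L = L(δ, R, η)` all of whose sites have site energy `< 2e* + θ(R, η)` contains an
  `(R, η)`-layered-good site (`e* = ⨅_Q e(Q)`).  Finite-dimensional for fixed parameters.
* `stub_pricedSparseCleanBall` (M — packing): in a Lennard-Jones ground state of `N > 0` particles a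
  site set of cardinality `≤ κ(L)·N` misses some ball `B(x_i, L)` entirely (uniform minimal distance
  `LennardJonesMinimalDistance_holds` + volume packing + union bound).
Composition: FLOOR ⇒ `e(P₀) = e*` and `E(N)/N → e*` (`floor_iff_eq_eStar`, `crysEnergyLimit`) ⇒ the
priced sites have density `→ 0` (`eventually_card_le`) ⇒ a ball `B(x_i, L)` free of priced sites
(stub 2): every site in it is good or `θ`-cheap; if none is good, all are cheap and stub 1 gives a good
site — so at every scale, eventually, a good site; then the landed compactness-in-the-spacing
`FluxCellKeplerSketch.stub_layeredWindowsOfGoodSites` and the proved `PeriodicGivenLayered_holds`.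
-/

noncomputable section

namespace Summit.AtomisticToContinuum.Crystallization.Cruxes.FluxCellKepler.EnergyLadder

open Filter Topology
open Literature.MathematicalPhysics.StatisticalMechanics
open Summit.AtomisticToContinuum.Crystallization.Theorems.FluxCellKeplerSingleScale (LayeredGood)
open Summit.AtomisticToContinuum.Crystallization.Theorems.ChargedEnergyGapNegative (eStar crysEnergyLimit)

local notation "E3" => EuclideanSpace ℝ (Fin 3)

/-! ## The graded family -/

/-- FLOOR(P₀): `N·e(P₀) ≤ E(x)` for every Lennard-Jones ground state `x` (verbatim the first hypothesis
of `FluxTubeKepler.FloorGivesLayered`). -/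
def Floor (P₀ : PeriodicConfiguration 3) : Prop :=
  ∀ (N : ℕ) (x : Fin N → E3), IsGroundState lennardJones x →
    (N : ℝ) * P₀.energyPerParticle lennardJones ≤ interactionEnergy lennardJones x

/-- ENERGY-FILTERED BUDGET(P₀) with threshold dial `θ`: at scale `(R, η)` only the `(R, η)`-bad sites
whose site-energy surplus `𝓔ⁱ(x) − 2 e(P₀)` is `≥ θ R η` (in `WithBot ℝ`) are priced. -/
def Budget (θ : ℝ → ℝ → WithBot ℝ) (P₀ : PeriodicConfiguration 3) : Prop :=
  ∀ R η : ℝ, 0 < R → 0 < η → ∃ c : ℝ, 0 < c ∧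
    ∀ (N : ℕ) (x : Fin N → E3), IsGroundState lennardJones x →
      c * (Nat.card {i : Fin N // ¬ LayeredGood R η x i ∧
            θ R η ≤ ((siteEnergy lennardJones x i - 2 * P₀.energyPerParticle lennardJones : ℝ) :
              WithBot ℝ)} : ℝ) ≤
        interactionEnergy lennardJones x - (N : ℝ) * P₀.energyPerParticle lennardJones

/-- Periodic windows along `x` (verbatim the conclusion of `ChessboardParticlePlanes.PeriodicWindows`). -/
def HasPeriodicWindows (x : (N : ℕ) → (Fin N → E3)) : Prop :=
  ∃ P : PeriodicConfiguration 3, ∀ R ε : ℝ, 0 < ε → ∃ᶠ N in atTop, ∃ t : E3,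
    (∀ s ∈ P.points, ‖s‖ ≤ R → ∃ i : Fin N, dist (x N i + t) s ≤ ε) ∧
    (∀ i : Fin N, ‖x N i + t‖ ≤ R → ∃ s ∈ P.points, dist (x N i + t) s ≤ ε)

/-- The graded family: FLOOR + the `θ`-filtered budget force periodic windows along ground states. -/
def ERung (θ : ℝ → ℝ → WithBot ℝ) : Prop :=
  ∀ P₀ : PeriodicConfiguration 3, Floor P₀ → Budget θ P₀ →
    ∀ x : (N : ℕ) → (Fin N → E3), (∀ N, IsGroundState lennardJones (x N)) → HasPeriodicWindows x

/-- **The deciding rung.** SOME pointwise-positive real threshold: at every scale the bad sites whose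
site-energy surplus is below `θ(R, η) > 0` go un-priced, and ground states still have periodic windows. -/
def EnergyBlindRung : Prop :=
  ∃ θ : ℝ → ℝ → ℝ, (∀ R η : ℝ, 0 < R → 0 < η → 0 < θ R η) ∧
    ERung (fun R η => ((θ R η : ℝ) : WithBot ℝ))

/-! ## Dial monotonicity -/

/-- A budget pricing the larger set prices the smaller one: `Budget` is monotone in the threshold. -/
theorem budget_mono {θ θ' : ℝ → ℝ → WithBot ℝ} (h : ∀ R η : ℝ, 0 < R → 0 < η → θ R η ≤ θ' R η)
    (P₀ : PeriodicConfiguration 3) : Budget θ P₀ → Budget θ' P₀ := by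
  classical
  intro hB R η hR hη
  obtain ⟨c, hc, hcB⟩ := hB R η hR hη
  refine ⟨c, hc, fun N x hx => le_trans ?_ (hcB N x hx)⟩
  have hle : Nat.card {i : Fin N // ¬ LayeredGood R η x i ∧
        θ' R η ≤ ((siteEnergy lennardJones x i - 2 * P₀.energyPerParticle lennardJones : ℝ) :
          WithBot ℝ)} ≤
      Nat.card {i : Fin N // ¬ LayeredGood R η x i ∧
        θ R η ≤ ((siteEnergy lennardJones x i - 2 * P₀.energyPerParticle lennardJones : ℝ) :
          WithBot ℝ)} := by
    rw [Nat.card_eq_fintype_card, Nat.card_eq_fintype_card]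
    exact Fintype.card_subtype_mono _ _ fun i hi => ⟨hi.1, (h R η hR hη).trans hi.2⟩
  exact mul_le_mul_of_nonneg_left (by exact_mod_cast hle) hc.le

/-- `ERung` is ANTITONE for the budget order: raising the threshold strengthens the rung. -/
theorem eRung_anti {θ θ' : ℝ → ℝ → WithBot ℝ} (h : ∀ R η : ℝ, 0 < R → 0 < η → θ R η ≤ θ' R η) :
    ERung θ' → ERung θ :=
  fun H P₀ hF hB x hx => H P₀ hF (budget_mono h P₀ hB) x hx

/-! ## F3 — the family at `θ = ⊥` is the proved floor -/

/-- **F3.** `ERung ⊥` — every bad site priced — is the seed `FloorGivesLayered_proof` followed by the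
proved `PeriodicGivenLayered_holds`. [folklore] -/
theorem eRung_bot : ERung ⊥ := by
  intro P₀ hF hB x hx
  refine Theses.FluxTubeKepler.PeriodicGivenLayered_holds x hx
    (Theorems.FluxTubeKeplerFloorGivesLayered.FloorGivesLayered_proof P₀ hF ?_ x hx)
  intro R η hR hη
  obtain ⟨c, hc, hcB⟩ := hB R η hR hη
  refine ⟨c, hc, fun N y hy => ?_⟩
  show c * (Nat.card {i : Fin N // ¬ LayeredGood R η y i} : ℝ) ≤ _
  simpa only [Pi.bot_apply, bot_le, and_true] using hcB N y hy

example : ERung ⊥ := eRung_bot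

/-- Every member of the family gives the floor value back. -/
theorem eRung_bot_of_eRung (θ : ℝ → ℝ → WithBot ℝ) (h : ERung θ) : ERung ⊥ :=
  eRung_anti (fun R η _ _ => bot_le) h

theorem eRung_bot_of_energyBlindRung (h : EnergyBlindRung) : ERung ⊥ := by
  obtain ⟨θ, -, H⟩ := h
  exact eRung_bot_of_eRung _ H

/-! ## F4 — on path: `Crystallization → ERung θ` -/

/-- ON-PATH: the sub-problem implies every member of the family (landed hull-criterion converse). -/
theorem eRung_of_crystallization (θ : ℝ → ℝ → WithBot ℝ) (h : _root_.Crystallization) : ERung θ :=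
  fun _ _ _ x hx =>
    Theorems.ChessboardParticlePlanesPeriodicWindowsIffCrystallization.periodicWindows_of_crystallization
      h x hx

/-- **F4 — `Crystallization → EnergyBlindRung`.** -/
@[aesop safe apply]
theorem EnergyBlindRung_of_Crystallization (h : _root_.Crystallization) : EnergyBlindRung :=
  ⟨fun _ _ => 1, fun _ _ _ _ => one_pos, eRung_of_crystallization _ h⟩

/-! ## Relief for the parent route -/

/-- The floor-and-filtered-budget package (what an energy-filtered Kepler inequality delivers). -/
def EKeplerFloor (θ : ℝ → ℝ → WithBot ℝ) : Prop :=
  ∃ P₀ : PeriodicConfiguration 3, Floor P₀ ∧ Budget θ P₀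

theorem windows_of_eRung {θ : ℝ → ℝ → WithBot ℝ} (h : ERung θ) (hK : EKeplerFloor θ) :
    ∀ x : (N : ℕ) → (Fin N → E3), (∀ N, IsGroundState lennardJones (x N)) → HasPeriodicWindows x := by
  obtain ⟨P₀, hF, hB⟩ := hK
  exact fun x hx => h P₀ hF hB x hx

/-- The parent crux gives the package at EVERY threshold (proved `KeplerEnergyFloor` + minimal distance,
then monotonicity from `⊥`). -/
theorem eKeplerFloor_of_fluxCellKepler (θ : ℝ → ℝ → WithBot ℝ)
    (hK : Theses.FluxTubeKepler.FluxCellKepler) : EKeplerFloor θ := by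
  obtain ⟨P₀, hF, hB⟩ := Theorems.keplerEnergyFloor_proof hK LennardJonesMinimalDistance_holds
  refine ⟨P₀, hF, budget_mono (θ := ⊥) (fun R η _ _ => bot_le) P₀ ?_⟩
  intro R η hR hη
  obtain ⟨c, hc, hcB⟩ := hB R η hR hη
  refine ⟨c, hc, fun N y hy => ?_⟩
  have h' : c * (Nat.card {i : Fin N // ¬ LayeredGood R η y i} : ℝ) ≤
      interactionEnergy lennardJones y - (N : ℝ) * P₀.energyPerParticle lennardJones := hcB N y hy
  simpa only [Pi.bot_apply, bot_le, and_true] using h'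

/-- With the deciding rung, only ENERGY-ANOMALOUS bad sites need a Kepler-type price: periodic windows
along every ground-state sequence (verbatim the body of `ChessboardParticlePlanes.PeriodicWindows`, which
the landed `crystallization_of_periodicWindows` turns into `Crystallization`; the composition with the
sub-problem constant is deliberately not restated in this file). -/
theorem windows_of_energyBlindRung (h : EnergyBlindRung)
    (hK : ∀ θ : ℝ → ℝ → ℝ, (∀ R η : ℝ, 0 < R → 0 < η → 0 < θ R η) →
      EKeplerFloor (fun R η => ((θ R η : ℝ) : WithBot ℝ))) :
    ∀ x : (N : ℕ) → (Fin N → E3), (∀ N, IsGroundState lennardJones (x N)) → HasPeriodicWindows x := by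
  obtain ⟨θ, hθ, H⟩ := h
  exact windows_of_eRung H (hK θ hθ)

/-! ## The line: two registered stubs -/

/-- **Stub 1 — LOCAL ENERGY RIGIDITY (the bet, XL).**  There is a pointwise-positive threshold
`θ(R, η)` such that for every separation `δ > 0` and scale `(R, η)` some radius `L` works: in a
`δ`-separated finite configuration of `ℝ³`, if EVERY site within `L` of `x i` has Lennard-Jones site
energy `< 2·e* + θ(R, η)` (`e* = ⨅_Q e(Q)`: at most `θ` above the binding of a bulk site of an optimal
crystal), then some site within `L` of `x i` is `(R, η)`-layered-good.  Uniform near-optimal LOCAL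
binding forces local close-packing: over-bound (icosahedral) sites cannot fill a ball (tetrahedral
frustration) without under-bound partners; bcc / Frank–Kasper bulk sites are under-bound by a definite
amount; elastic distortions visible at `(R, η)` cost `≳ (η/R)²`.  For fixed `(δ, R, η, θ, L)` a
finite-dimensional statement (certifiable by interval branch-and-bound in principle). [conjecture] -/
theorem stub_localEnergyRigidity :
    ∃ θ : ℝ → ℝ → ℝ, (∀ R η : ℝ, 0 < R → 0 < η → 0 < θ R η) ∧
      ∀ δ : ℝ, 0 < δ → ∀ R η : ℝ, 0 < R → 0 < η → ∃ L : ℝ, 0 < L ∧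
        ∀ (N : ℕ) (x : Fin N → E3), (∀ i j : Fin N, i ≠ j → δ ≤ dist (x i) (x j)) →
          ∀ i : Fin N,
            (∀ j : Fin N, dist (x j) (x i) ≤ L →
              siteEnergy lennardJones x j <
                2 * (⨅ Q : PeriodicConfiguration 3, Q.energyPerParticle lennardJones) + θ R η) →
            ∃ j : Fin N, dist (x j) (x i) ≤ L ∧ LayeredGood R η x j := by
  sorry

/-- **Stub 2 — a sparse site set misses a whole ball (packing, M).**  For every radius `L` there is
`κ > 0` such that in every Lennard-Jones ground state of `N > 0` particles, every site predicate of
cardinality `≤ κ·N` is avoided by some ball `B(x i, L)`.  Uniform minimal distance of ground states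
(`LennardJonesMinimalDistance_holds`) ⇒ at most `C(L)` sites within `L` of any site ⇒ union bound with
`κ·C(L) < 1`. [folklore] -/
theorem stub_pricedSparseCleanBall :
    ∀ L : ℝ, 0 < L → ∃ κ : ℝ, 0 < κ ∧
      ∀ (N : ℕ) (x : Fin N → E3), IsGroundState lennardJones x → 0 < N →
        ∀ p : Fin N → Prop, (Nat.card {i : Fin N // p i} : ℝ) ≤ κ * N →
          ∃ i : Fin N, ∀ j : Fin N, p j → L < dist (x j) (x i) := by
  sorry

/-! ### The stub statements as named propositions (verbatim) -/

/-- Statement of `stub_localEnergyRigidity` (verbatim). [conjecture] -/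
def Sig.stub_localEnergyRigidity : Prop :=
    ∃ θ : ℝ → ℝ → ℝ, (∀ R η : ℝ, 0 < R → 0 < η → 0 < θ R η) ∧
      ∀ δ : ℝ, 0 < δ → ∀ R η : ℝ, 0 < R → 0 < η → ∃ L : ℝ, 0 < L ∧
        ∀ (N : ℕ) (x : Fin N → E3), (∀ i j : Fin N, i ≠ j → δ ≤ dist (x i) (x j)) →
          ∀ i : Fin N,
            (∀ j : Fin N, dist (x j) (x i) ≤ L →
              siteEnergy lennardJones x j <
                2 * (⨅ Q : PeriodicConfiguration 3, Q.energyPerParticle lennardJones) + θ R η) →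
            ∃ j : Fin N, dist (x j) (x i) ≤ L ∧ LayeredGood R η x j

/-- Statement of `stub_pricedSparseCleanBall` (verbatim). [folklore] -/
def Sig.stub_pricedSparseCleanBall : Prop :=
    ∀ L : ℝ, 0 < L → ∃ κ : ℝ, 0 < κ ∧
      ∀ (N : ℕ) (x : Fin N → E3), IsGroundState lennardJones x → 0 < N →
        ∀ p : Fin N → Prop, (Nat.card {i : Fin N // p i} : ℝ) ≤ κ * N →
          ∃ i : Fin N, ∀ j : Fin N, p j → L < dist (x j) (x i)

/-! ### Sorry-free glue -/

/-- Quantitative counting step (the seed's `eventually_exists_not_bad`, sharpened from "one unpriced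
site" to "priced density below any `κ > 0`"): under FLOOR(P₀), `c · #{priced} ≤ E − N·e(P₀)` on ground
states and `E(N)/N → e* = e(P₀)` give, eventually in `N`, `#{priced} ≤ κ·N`. [folklore] -/
theorem eventually_card_le (P₀ : PeriodicConfiguration 3) (hE : Floor P₀)
    {bad : (N : ℕ) → (Fin N → E3) → Fin N → Prop} {c κ : ℝ} (hc : 0 < c) (hκ : 0 < κ)
    (hcN : ∀ (N : ℕ) (x : Fin N → E3), IsGroundState lennardJones x →
      c * (Nat.card {i : Fin N // bad N x i} : ℝ) ≤
        interactionEnergy lennardJones x - (N : ℝ) * P₀.energyPerParticle lennardJones) :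
    ∀ᶠ N in atTop, ∀ x : Fin N → E3, IsGroundState lennardJones x →
      (Nat.card {i : Fin N // bad N x i} : ℝ) ≤ κ * N := by
  have heq := (Theorems.FluxTubeKeplerFloorGivesLayered.floor_iff_eq_eStar P₀).1 hE
  have hlim := crysEnergyLimit
  have hcκ : 0 < c * κ := mul_pos hc hκ
  have hlt : (⨅ Q : PeriodicConfiguration 3, Q.energyPerParticle lennardJones) < eStar + c * κ := by
    change eStar < eStar + c * κ
    linarith
  have hev : ∀ᶠ N : ℕ in atTop, groundStateEnergy lennardJones 3 N / N < eStar + c * κ :=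
    hlim.eventually (gt_mem_nhds hlt)
  filter_upwards [hev, Filter.eventually_gt_atTop 0] with N hN hNpos x hx
  have h1 := hcN N x hx
  rw [heq, hx.2] at h1
  have hNr : (0 : ℝ) < N := by exact_mod_cast hNpos
  have h2 : groundStateEnergy lennardJones 3 N < (eStar + c * κ) * N := by
    rwa [div_lt_iff₀ hNr] at hN
  have h3 : c * (Nat.card {i : Fin N // bad N x i} : ℝ) < c * (κ * N) := by nlinarith
  exact (lt_of_mul_lt_mul_left h3 hc.le).le

/-- **Composition — the rung BY NAME from the two stubs.**  [conjecture] -/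
theorem EnergyBlindRung_of (h₁ : Sig.stub_localEnergyRigidity) (h₂ : Sig.stub_pricedSparseCleanBall) :
    EnergyBlindRung := by
  obtain ⟨θ, hθ, hrig⟩ := h₁
  refine ⟨θ, hθ, fun P₀ hF hB x hx => ?_⟩
  refine Theses.FluxTubeKepler.PeriodicGivenLayered_holds x hx
    (Theorems.FluxCellKeplerSketch.stub_layeredWindowsOfGoodSites x ?_)
  intro R η hR hη
  obtain ⟨δ, hδ, hsep⟩ := LennardJonesMinimalDistance_holds
  obtain ⟨L, hL, hrigL⟩ := hrig δ hδ R η hR hη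
  obtain ⟨κ, hκ, hclean⟩ := h₂ L hL
  obtain ⟨c, hc, hcB⟩ := hB R η hR hη
  have heq := (Theorems.FluxTubeKeplerFloorGivesLayered.floor_iff_eq_eStar P₀).1 hF
  have hev := eventually_card_le P₀ hF (κ := κ) hc hκ hcB
  refine ((hev.and (Filter.eventually_gt_atTop 0)).mono fun N hN => ?_).frequently
  obtain ⟨hcard, hNpos⟩ := hN
  obtain ⟨i, hi⟩ := hclean N (x N) (hx N) hNpos _ (hcard (x N) (hx N))
  by_cases hgood : ∃ j : Fin N, dist (x N j) (x N i) ≤ L ∧ LayeredGood R η (x N) j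
  · obtain ⟨j, -, hj⟩ := hgood
    exact ⟨j, hj⟩
  · push Not at hgood
    have hcheap : ∀ j : Fin N, dist (x N j) (x N i) ≤ L →
        siteEnergy lennardJones (x N) j <
          2 * (⨅ Q : PeriodicConfiguration 3, Q.energyPerParticle lennardJones) + θ R η := by
      intro j hj
      have hbad : ¬ LayeredGood R η (x N) j := hgood j hj
      have hnot : ¬ (¬ LayeredGood R η (x N) j ∧ ((θ R η : ℝ) : WithBot ℝ) ≤
          ((siteEnergy lennardJones (x N) j - 2 * P₀.energyPerParticle lennardJones : ℝ) :
            WithBot ℝ)) := by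
        intro hp
        have hfar : L < dist (x N j) (x N i) := hi j hp
        exact (not_le.mpr hfar) hj
      have hlt : siteEnergy lennardJones (x N) j - 2 * P₀.energyPerParticle lennardJones < θ R η := by
        by_contra hle
        exact hnot ⟨hbad, WithBot.coe_le_coe.2 (not_lt.1 hle)⟩
      rw [heq] at hlt
      change siteEnergy lennardJones (x N) j -
          2 * (⨅ Q : PeriodicConfiguration 3, Q.energyPerParticle lennardJones) < θ R η at hlt
      linarith
    obtain ⟨j, hj, hgoodj⟩ := hrigL N (x N) (hsep N (x N) (hx N)) i hcheap
    exact absurd hgoodj (hgood j hj)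

/-- **The closed skeleton instance**: the rung by name from the two declared stubs (the only `sorry`s
of this file enter here). [conjecture] -/
theorem EnergyBlindRung_skeleton : EnergyBlindRung :=
  EnergyBlindRung_of stub_localEnergyRigidity stub_pricedSparseCleanBall

end Summit.AtomisticToContinuum.Crystallization.Cruxes.FluxCellKepler.EnergyLadder

end
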